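import Summits.ResolutionOfSingularities.ResolutionOfSingularities.Theorems.EquisingularLiftEquisingularLiftNatSubchainSupplierInvSDefs
import HarnessLib

/-!
# [OURS · L1 W4.5(b) · EL♮(3) · T23-A″-S] HSUB′(ReachTowerB″-S) — THE SHADOW-FREE INNER-CHAIN INVARIANT WITH THE PLANE TRACE (definitions)
# `TCPlus.MemberS₀`, `TCPlus.InvS₀` = res-L1-w45b-stub-1's `TCPlus.Member` / `TCPlus.Inv` (…NatSubchainSupplierInvDefs) + clauses (viii) Cartier,
# (ix) plane trace `𝓢.comap jG = 𝓘⟨closure S_d⟩`, (x) plane flatness — the `K₂ = ∅` (shadow FORGOTTEN) arm of the S-chain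
# (sibling of …NatSubchainSupplierInvSDefs p617224, which is the KCL-based arm)

res-type-027 g18 (object «A″-S UPSTAIRS TWINS», shadow-free arm «R-b»: res-L1-w45b-stub-4 WORD 2026-08-28T08:56:25Z «R-b — GO NOW», desk DEAL
09:01:29Z; specification = stub-4's T23-A″ ENGINE WORD 16d03a46d50c8ccd §S (ii) + the (D2) text `ReachTowerBDoublePrimeS` (res-L1-w45b-lead-1 p618927),
whose S-disjunct keeps BOTH seed-shadow arms `K₂ = ∅ ∨ (ConeForm ∧ K₂ = St_x W)`).
Crux `EquisingularLiftNatThree` = stmt-ResolutionOfSingularities-20148 (parent `EquisingularLiftNat` = stmt-…-20038), route `EquisingularLift`,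
line `sections`. OURS; NOT a statement of any manuscript ([Hironaka2017] is a candidate under adjudication, nothing of it is asserted);
AI-written, weaker than expert review. Definitions + pure-logic projections only (no `sorry`, no instance, no notation; standard axioms).
`--supports stmt-ResolutionOfSingularities-20148 --as helper`.

WHY (stub-4's «R-b» word). V10‴'s inner motive in the S-branch is `INV_S W G β T Z K S b := (K = ∅ ∧ InvS₀ … ∧ S-side facts) ∨
(InvS … ∧ K-side facts ∧ S-side facts)`: when the seed shadow is FORGOTTEN (`K₂ = ∅`: non-conical `W`, or the chain chose to forget the cone) the
inner chain runs on res-L1-w45b-stub-1's K-free `TCPlus.Inv`, and the plane's model must still be carried to the seed of the round phase. So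
`TCPlus.MemberS₀ … G T Z S_d excl` = body of `TCPlus.Member` VERBATIM ∧ (viii) `IsEffectiveCartier (𝓢.comap K.subschemeι)` (the Cartier clause of
res-D-pv-029's `MemberKC` — needed by the co-host transport `coneRound_exceptional_comap 𝓢 K` at the curve step even with the shadow forgotten, via
`isEffectiveCartier_comap_subschemeι_swap`) ∧ (ix) `𝓢.comap jG = 𝓘⟨closure S_d⟩` ∧ (x) `Flat (𝓢.subschemeι ≫ σ ≫ q)`; NO shadow clause (vii)/(vii-loc).
`TCPlus.InvS₀` = `TCPlus.Inv` with `MemberS₀` in both member clauses. Projections: `memberS₀_member` / `invS₀_inv` (every `Inv` consumer applies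
unchanged), `memberS_memberS₀` / `invS_invS₀` (the KCL arm forgets its shadow into this one), `invS₀_memberS₀`.
The bricks (res-type-027, separate files) are the KCL-arm S bricks with the (vii-loc) block DELETED: base over res-type-100's `inv_base` /
`tcPlus_member_{un,}centred`, steps over res-L1-w45b-stub-4 / -stub-1's `member_strictTransform_of_{regular,centred}Point` (+ the (viii) blocks of the
KC twins, + (ix)/(x) as in the S twins), curve over res-D-pv-029's `Tower.inv₂_of_inv_curveStep_forget` with the SAME seeded-member block as
`Tower.invB_of_invS_curveStep` (p618350), concluding `Tower.InvB … (St T₉) (υ'⁻¹Z₉) [St S₉] ∅`.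
-/

set_option linter.dupNamespace false -- mandated namespace `Summit.<Summit>.<Problem>` of this single-conjunct summit
set_option linter.overlappingInstances false -- signatures carry `[IsDomain O] [IsDiscreteValuationRing O]`

noncomputable section

open CategoryTheory CategoryTheory.Limits AlgebraicGeometry TopologicalSpace Topology IsLocalRing
open Literature.AlgebraicGeometry.Resolution
open AlgebraicGeometry.Scheme.IdealSheafData

namespace Summit.ResolutionOfSingularities.ResolutionOfSingularities.Cruxes.EquisingularLiftNat.Sections.TCPlus

variable (O : Type) [CommRing O] [IsDomain O] [IsDiscreteValuationRing O] (k : Type) [Field k] (θ : O →+* k)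
  (P : Scheme.{0}) (q : P ⟶ Spec (.of O)) (Y : Set P) (Ch : ∀ X' : Scheme.{0}, (X' ⟶ P) → Set X' → Prop)

/-- **`TCPlus.MemberS₀` — a SHADOW-FREE member carrying the Cartier clause AND THE PLANE TRACE**: `TCPlus.Member O k θ P q Y Ch G T Z excl`
(clauses (i)–(vi) VERBATIM, see …NatSubchainSupplierInvDefs) ∧ (viii) `IsEffectiveCartier (𝓢.comap K.subschemeι)` ∧ (ix) `𝓢.comap jG = 𝓘⟨closure S_d⟩`
∧ (x) `Flat (𝓢.subschemeι ≫ σ ≫ q)`; no shadow clause. [OURS · L1 W4.5b · T23-A″-S] -/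
def MemberS₀ (G : Scheme.{0}) (T Z Sd : Set G) (excl : Set G) : Prop :=
  ∃ (X : Scheme.{0}) (σ : X ⟶ P) (S : Set X) (jG : G ⟶ X) (tG : G ⟶ Spec (.of k)) (𝓢 K : X.IdealSheafData),
    Ch X σ S ∧ IsIntegral X ∧ IsLocallyNoetherian X ∧ Scheme.IsRegular X ∧ IsDominant (σ ≫ q) ∧
    IsPullback jG tG (σ ≫ q) (Spec.map (CommRingCat.ofHom θ)) ∧ jG '' T = S ∧
    -- (i) exact special fibre
    (𝓢 ⊔ K).comap jG = vanishingIdeal (⟨closure Z, isClosed_closure⟩ : Closeds G) ∧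
    -- (ii) flat over `O`
    Flat ((𝓢 ⊔ K).subschemeι ≫ σ ≫ q) ∧
    -- (iii) the carrier is regular, both ideal sheaves are locally principal
    Scheme.IsRegular 𝓢.subscheme ∧ (∀ z : X, (stalkIdeal 𝓢 z).IsPrincipal ∧ (stalkIdeal K z).IsPrincipal) ∧
    -- (iv) off the generic point of `Y`
    σ '' ((𝓢 ⊔ K).support : Set X) ⊆ {y : P | ¬ IsGenericPoint y Y} ∧
    -- (v) regular quotient stalks at the special points, off the excluded ones — of codimension `2` at the closed ones
    (∀ z ∈ ((𝓢 ⊔ K).support : Set X), (σ ≫ q) z = closedPoint O → z ∉ jG '' excl →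
      IsRegularLocalRing (X.presheaf.stalk z ⧸ stalkIdeal (𝓢 ⊔ K) z) ∧
      (IsClosed ({z} : Set X) →
        ringKrullDim (X.presheaf.stalk z ⧸ stalkIdeal (𝓢 ⊔ K) z) + 2 = ringKrullDim (X.presheaf.stalk z))) ∧
    -- (vi) centred packages at the excluded points
    (∀ y₀ ∈ excl, CentredPackage O P q X σ 𝓢 K (jG y₀)) ∧
    -- (viii) the carrier cuts an effective Cartier divisor on the cone (NO shadow clause (vii) in this arm)
    IsEffectiveCartier (𝓢.comap K.subschemeι) ∧
    -- (ix) THE PLANE TRACE: the carrier's special fibre is the reduced downstairs plane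
    𝓢.comap jG = vanishingIdeal (⟨closure Sd, isClosed_closure⟩ : Closeds G) ∧
    -- (x) the plane's model is flat over `O` ON ITS OWN (the seeded member's `FE` datum)
    Flat (𝓢.subschemeι ≫ σ ≫ q)

/-- **`TCPlus.InvS₀` — the shadow-free inner invariant with Cartier clause and plane trace, `INV W G β T Z S_d b`**: `TCPlus.Inv` with
`MemberS₀` in both member clauses, the plane `S_d` threaded. [OURS · L1 W4.5b · T23-A″-S] -/
def InvS₀ {F₁ F₂ : Scheme.{0}} (_W : Set F₁) (G : Scheme.{0}) (_β : G ⟶ F₂) (T Z Sd : Set G) (b : Bool) : Prop :=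
  IsIntegral G ∧ IsClosed T ∧ IsIrreducible T ∧ ¬ T ⊆ closure Z ∧ MemberS₀ O k θ P q Y Ch G T Z Sd ∅ ∧
    (b = false → ∀ y : ↥(vanishingIdeal (⟨closure Z, isClosed_closure⟩ : Closeds G)).subscheme,
      IsClosed ({((vanishingIdeal (⟨closure Z, isClosed_closure⟩ : Closeds G)).subschemeι y : G)} : Set G) →
      ¬ IsRegularLocalRing ((vanishingIdeal (⟨closure Z, isClosed_closure⟩ : Closeds G)).subscheme.presheaf.stalk y) →
      MemberS₀ O k θ P q Y Ch G T Z Sd {((vanishingIdeal (⟨closure Z, isClosed_closure⟩ : Closeds G)).subschemeι y : G)})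

/-! ## Pure-logic projections -/

/-- `MemberS₀ ⇒ Member` (forget (viii), (ix), (x)). [OURS · pure logic] -/
theorem memberS₀_member {G : Scheme.{0}} {T Z Sd excl : Set G} (h : MemberS₀ O k θ P q Y Ch G T Z Sd excl) :
    Member O k θ P q Y Ch G T Z excl := by
  obtain ⟨X, σ, S, jG, tG, 𝓢, K, hCh, hXint, hXnoeth, hXreg, hdom, hsq, hTS, hi, hii, hiii, hiiip, hiv, hv, hvi, -, -, -⟩ := h
  exact ⟨X, σ, S, jG, tG, 𝓢, K, hCh, hXint, hXnoeth, hXreg, hdom, hsq, hTS, hi, hii, hiii, hiiip, hiv, hv, hvi⟩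

/-- `MemberS ⇒ MemberS₀` (the KCL arm forgets its shadow clause (vii-loc)). [OURS · pure logic] -/
theorem memberS_memberS₀ {G : Scheme.{0}} {T Z Kd Sd excl : Set G} (h : MemberS O k θ P q Y Ch G T Z Kd Sd excl) :
    MemberS₀ O k θ P q Y Ch G T Z Sd excl := by
  obtain ⟨X, σ, S, jG, tG, 𝓢, K, hCh, hXint, hXnoeth, hXreg, hdom, hsq, hTS, hi, hii, hiii, hiiip, hiv, hv, hvi, -, hviii, hix, hx⟩ := h
  exact ⟨X, σ, S, jG, tG, 𝓢, K, hCh, hXint, hXnoeth, hXreg, hdom, hsq, hTS, hi, hii, hiii, hiiip, hiv, hv, hvi, hviii, hix, hx⟩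

/-- The plane-trace clauses of a shadow-free member, for the record: the carrier is an upstairs ideal sheaf, locally principal with REGULAR
zero locus, `O`-flat, whose special fibre is EXACTLY `𝓘⟨closure S_d⟩`, for SOME realisation. [OURS · pure logic] -/
theorem memberS₀_plane {G : Scheme.{0}} {T Z Sd excl : Set G} (h : MemberS₀ O k θ P q Y Ch G T Z Sd excl) :
    ∃ (X : Scheme.{0}) (σ : X ⟶ P) (jG : G ⟶ X) (tG : G ⟶ Spec (.of k)) (𝓢 : X.IdealSheafData),
      IsPullback jG tG (σ ≫ q) (Spec.map (CommRingCat.ofHom θ)) ∧ (∀ z : X, (stalkIdeal 𝓢 z).IsPrincipal) ∧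
      Scheme.IsRegular 𝓢.subscheme ∧ 𝓢.comap jG = vanishingIdeal (⟨closure Sd, isClosed_closure⟩ : Closeds G) ∧
      Flat (𝓢.subschemeι ≫ σ ≫ q) := by
  obtain ⟨X, σ, S, jG, tG, 𝓢, K, -, -, -, -, -, hsq, -, -, -, hiii, hiiip, -, -, -, -, hix, hx⟩ := h
  exact ⟨X, σ, jG, tG, 𝓢, hsq, fun z => (hiiip z).1, hiii, hix, hx⟩

/-- `InvS₀ ⇒ Inv` (res-L1-w45b-stub-1's invariant). [OURS · pure logic] -/
theorem invS₀_inv {F₁ F₂ : Scheme.{0}} {W : Set F₁} {G : Scheme.{0}} {β : G ⟶ F₂} {T Z Sd : Set G} {b : Bool}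
    (h : InvS₀ O k θ P q Y Ch W G β T Z Sd b) : Inv O k θ P q Y Ch W G β T Z b := by
  obtain ⟨hG, hT, hTirr, hTZ, hmem, hcen⟩ := h
  exact ⟨hG, hT, hTirr, hTZ, memberS₀_member O k θ P q Y Ch hmem,
    fun hb y hy hreg => memberS₀_member O k θ P q Y Ch (hcen hb y hy hreg)⟩

/-- `InvS ⇒ InvS₀` (forget the shadow, keep the plane). [OURS · pure logic] -/
theorem invS_invS₀ {F₁ F₂ : Scheme.{0}} {W : Set F₁} {G : Scheme.{0}} {β : G ⟶ F₂} {T Z Kd Sd : Set G} {b : Bool}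
    (h : InvS O k θ P q Y Ch W G β T Z Kd Sd b) : InvS₀ O k θ P q Y Ch W G β T Z Sd b := by
  obtain ⟨hG, hT, hTirr, hTZ, hmem, hcen⟩ := h
  exact ⟨hG, hT, hTirr, hTZ, memberS_memberS₀ O k θ P q Y Ch hmem,
    fun hb y hy hreg => memberS_memberS₀ O k θ P q Y Ch (hcen hb y hy hreg)⟩

/-- The uncentred member's plane trace, read off `InvS₀`. [OURS · pure logic] -/
theorem invS₀_memberS₀ {F₁ F₂ : Scheme.{0}} {W : Set F₁} {G : Scheme.{0}} {β : G ⟶ F₂} {T Z Sd : Set G} {b : Bool}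
    (h : InvS₀ O k θ P q Y Ch W G β T Z Sd b) : MemberS₀ O k θ P q Y Ch G T Z Sd ∅ :=
  h.2.2.2.2.1

end Summit.ResolutionOfSingularities.ResolutionOfSingularities.Cruxes.EquisingularLiftNat.Sections.TCPlus

end
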